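import Summits.BirchSwinnertonDyer.Rank1Residual.Partition.MainConjecturesRankZeroMazur
import Literature.NumberTheory.EllipticCurves.Greenberg1999.RankZeroEulerCharacteristicOddPrimeProofs
import HarnessLib

/-!
# The cell's main-conjecture-level skeletons WITHOUT the Greenberg 1999 Thm. 4.1 binder
# (cell `b2b-bsdres`, literature typer `b2b-bsdres-lit-su`, gen 8; companion of
# `Partition/MainConjectures.lean` §1 and `Partition/MainConjecturesRankZeroMazur.lean`)

HONEST FRAMING (cell `b2b-bsdres`, run/shared/lean/b2b/bsd-rank1-residual/, verbatim in every
file): the goal of the cell is to DELETE the COMBINATION-SHAPED residual classes of the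
Birch–Swinnerton-Dyer formula for ALL analytic-rank `≤ 1` elliptic curves over `ℚ` — "full BSD
formula for every rank `≤ 1` curve in class `C`" assembled STRICTLY from published theorems — so
that the rank-`≤ 1` remainder becomes exactly the CONSTRUCTION-SHAPED classes, which are TYPED
(missing-input `Prop`s), NOT attempted. This is not "finishing BSD". Research routes; no claim
beyond the stated classes; nothing booked; no label changes. THEOREMS ONLY (no definition, no named
fact, no `sorry`); every published theorem enters as one of the tree's existing named Literature
facts BY NAME.

## What this file records

The universal main-conjecture-level skeleton of the cell for analytic rank `≤ 1` at an odd good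
ordinary prime, `bsdp_of_mazurMainConjecture_of_analyticRank_le_one_of_schneider`
(`Partition/MainConjectures.lean` §1, GLUE gen 0), carries SIX registry binders: Greenberg 1999
Thm. 4.1 (`hGr`, rank `0`), Balakrishnan–Müller–Stein 2016 Thm. 1.7 at odd `p` (`hS`, rank `1`),
Perrin-Riou's `p`-adic Gross–Zagier (`hPR`), the Mazur–Tate `σ`-function at odd `p` (`hMT`),
modularity (`hmod`), Gross–Zagier–Kolyvagin (`hGZK`). The first is REDUNDANT given the second and the
fourth: Greenberg's Thm. 4.1 is the rank-`0` case of BMS Thm. 1.7 ("The case `r = 0` is Greenberg's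
Thm. 4.1", docstring of `IwasawaLeadingTerm`), and at every odd good ordinary prime the fact's
canonical-height binder is instantiated from the `σ`-function — kernel theorem
`greenberg_charValue_rankZero_of_Schneider1985_odd`
(`Literature/…/Greenberg1999/RankZeroEulerCharacteristicOddPrimeProofs.lean`, lit-su gen 8; the
`p ≥ 5` half was the tree's `greenberg_rankZero_of_Schneider1985`, the prime `3` was missing).
`Partition/MainConjectures.lean` is append-only and not this seat's, so the five-binder forms are
given here under new names:

* `bsdp_of_mazurMainConjecture_of_analyticRank_le_one_of_schneider_odd` — `r ≤ 1`, odd good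
  ordinary `p`, ANY image: `MazurMainConjecture W p` + {BMS 1.7 (odd), Perrin-Riou 1987, MST `σ` (odd),
  modularity, GZK} (+ the Schneider certificate at `r = 1`) ⟹ `BSDp W p` — FIVE registry binders;
* `bsdp_of_mazurMainConjecture_of_analyticRank_eq_zero_of_schneider_odd` — the rank-`0` skeleton in
  the same currency (useful only to a consumer that already holds `hS`, `hMT`; otherwise the gen-0 form
  with the single binder `hGr` is lighter);
* `RowC1.bsdp_of_mainConjectures_of_schneider_odd` — row C1 (the Skinner–Urban route, rank `0`) in
  the two-rank currency: {S–U 3.6.9, Skinner Thm. A, BMS 1.7 (odd), MST `σ` (odd), Mazur 1978 Cor. 4.1,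
  SW 6.1 ×2, Greenberg–Stevens, modularity ×2, GZK}.

Consequence for the registry (CITED-FACTS): every two-rank theorem of the cell that lists
`(hGr) (hS : Schneider1985_order_charGenerator_odd) (hMT : mazur_tate_sigma_exists_odd)` — the gen-0
skeleton, `X10.bsdp_three_of_mazurMainConjecture`, the X1 Keller–Yin / partner files, the CM
`p = 3` files — can drop `hGr` (`:= greenberg_charValue_rankZero_of_Schneider1985_odd hS hMT`); the
Greenberg 1999 Thm. 4.1 row is carried as DERIVED ⇐ {BMS 2016 Thm. 1.7 (odd `p`), MST 2006 Thm. 1.3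
(odd `p`)}. No statement of any existing theorem changes.

References: [GreenbergLNM1716] Thm. 4.1 (p. 102); [BalakrishnanMullerStein2015] Thm. 1.7, p. 3;
[MazurSteinTate2006] Thm. 1.3; [PerrinRiou1987] §1.4 Cor. 1.8; [CastellaEtAl2021] Thm. 5.1.4 (proof);
[SkinnerUrban2014] Thm. 3.6.9 (p. 45), proof of Thm. 3.6.11 (p. 46); [Skinner2016PacificMC] Thm. A,
Thm. C; [Mazur1978] Cor. 4.1; [Miller2011LMS] Def. 1.1; HOME/b2b-bsdres-lit-su/SU2014-TYPING.md §14.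
-/

set_option autoImplicit false

noncomputable section

open scoped Classical MatrixGroups ModularForm

open CongruenceSubgroup WeierstrassCurve Literature.NumberTheory.EllipticCurves
  Literature.NumberTheory.EllipticCurves.ModularForms
  Literature.NumberTheory.EllipticCurves.Rank1Residual
  Literature.NumberTheory.EllipticCurves.Skinner2016
  Literature.NumberTheory.EllipticCurves.SteinWuthrich2013
  Summit.BirchSwinnertonDyer.BirchSwinnertonDyer.Theorems.Rank1ResidualX1Defs

namespace Summit.BirchSwinnertonDyer.Rank1Residual

section Curve

variable {W : WeierstrassCurve ℚ} [W.IsElliptic] [W.IsGloballyMinimal] {p : ℕ} [Fact p.Prime]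

/-- **Rank `≤ 1`, good ordinary ODD `p`, ANY image, modulo the Schneider certificate at `r = 1`:
Mazur's main conjecture for `(E,p)` ⟹ `BSD(E,p)` from FIVE registry binders** — GLUE gen 0's
`bsdp_of_mazurMainConjecture_of_analyticRank_le_one_of_schneider` with its Greenberg 1999 Thm. 4.1
binder `hGr` DISCHARGED from `hS` (BMS 2016 Thm. 1.7 at odd `p`, whose case `r = 0` is Greenberg's
theorem) and `hMT` (the Mazur–Tate `σ`-function at odd `p`, for the canonical-height binder) by
`greenberg_charValue_rankZero_of_Schneider1985_odd`. [cite: GreenbergLNM1716, Thm. 4.1 (p. 102)]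
[cite: BalakrishnanMullerStein2015, Thm. 1.7 and p. 3] [cite: MazurSteinTate2006, Thm. 1.3]
[cite: PerrinRiou1987, §1.4 Cor. 1.8] [cite: CastellaEtAl2021, Thm. 5.1.4 (proof, §5.1.3)] -/
theorem bsdp_of_mazurMainConjecture_of_analyticRank_le_one_of_schneider_odd
    (hS : Schneider1985_order_charGenerator_odd) (hPR : perrinRiou_rankOne_leadingTerms_odd)
    (hMT : mazur_tate_sigma_exists_odd) (hmod : nonempty_modularParametrizationData)
    (hGZK : rank_eq_analyticRank_of_analyticRank_le_one)
    (hp : p ≠ 2) (hord : GoodOrd W p) (hr : W.analyticRank ≤ 1)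
    (hSch : W.analyticRank = 1 → ∀ Dh : PAdicHeightData W p, Dh.IsCanonical → SchneiderConjecture Dh)
    (hMC : MazurMainConjecture W p) : BSDp W p :=
  bsdp_of_mazurMainConjecture_of_analyticRank_le_one_of_schneider
    (greenberg_charValue_rankZero_of_Schneider1985_odd hS hMT) hS hPR hMT hmod hGZK hp hord hr hSch hMC

/-- **Rank `0`, good ordinary odd `p`, ANY image: Mazur's main conjecture for `(E,p)` ⟹ `BSD(E,p)`**
in the two-rank currency — GLUE gen 0's `bsdp_of_mazurMainConjecture_of_analyticRank_eq_zero` with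
`hGr` supplied from `hS` + `hMT` (`greenberg_charValue_rankZero_of_Schneider1985_odd`). For a consumer
that holds only rank-`0` rows the gen-0 form (one binder `hGr`) is lighter; this form serves the
two-rank theorems that already list `hS`, `hMT`. [cite: GreenbergLNM1716, Thm. 4.1 (p. 102)]
[cite: BalakrishnanMullerStein2015, Thm. 1.7 and p. 3] [cite: MazurSteinTate2006, Thm. 1.3]
[cite: CastellaEtAl2021, Thm. 5.1.4 (proof, §5.1.3)] [cite: Miller2011LMS, Def. 1.1] -/
theorem bsdp_of_mazurMainConjecture_of_analyticRank_eq_zero_of_schneider_odd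
    (hS : Schneider1985_order_charGenerator_odd) (hMT : mazur_tate_sigma_exists_odd)
    (hmod : nonempty_modularParametrizationData)
    (hGZK : rank_eq_analyticRank_of_analyticRank_le_one)
    (hp : p ≠ 2) (hord : GoodOrd W p) (hr0 : W.analyticRank = 0) (hMC : MazurMainConjecture W p) :
    BSDp W p :=
  bsdp_of_mazurMainConjecture_of_analyticRank_eq_zero
    (greenberg_charValue_rankZero_of_Schneider1985_odd hS hMT) hmod hGZK hp hord hr0 hMC

/-- **C1 at main-conjecture level in the two-rank currency**: `RowC1 W p ⟹ BSDp W p` from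
{Skinner–Urban 2014 Thm. 3.6.9, Skinner 2016 Thm. A, BMS 2016 Thm. 1.7 (odd `p`), MST 2006 `σ`
(odd `p`), Stein–Wuthrich 2013 Thm. 6.1 (split, non-split), Greenberg–Stevens, Mazur 1978 Cor. 4.1,
modularity (analytic continuation; modular parametrisation), Gross–Zagier–Kolyvagin} —
`RowC1.bsdp_of_mainConjectures_of_mazur` with `hGr := greenberg_charValue_rankZero_of_Schneider1985_odd
hS hMT`. [cite: Skinner2016PacificMC, Thm. C, Thm. A, §3.2–3.3]
[cite: SkinnerUrban2014, Thm. 3.6.9 (p. 45), proof of Thm. 3.6.11 (p. 46)]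
[cite: BalakrishnanMullerStein2015, Thm. 1.7 and p. 3] [cite: Mazur1978, Cor. 4.1] -/
theorem RowC1.bsdp_of_mainConjectures_of_schneider_odd
    (hSU : ∀ (W : WeierstrassCurve ℚ) [W.IsElliptic] [W.IsGloballyMinimal] (p : ℕ) [Fact p.Prime]
      (κ : ZpExtension ℚ p) (γ : Field.absoluteGaloisGroup ℚ) (N : ℕ) [NeZero N]
      (f : CuspForm (Gamma0 N) 2),
      skinner_urban_main_conjecture W p (κ := κ) (γ := γ) (f := f))
    (hA : thmA_charIdeal_multiplicative)
    (hS : Schneider1985_order_charGenerator_odd) (hMT : mazur_tate_sigma_exists_odd)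
    (hJs : thm61_splitMultiplicative) (hJn : thm61_nonsplitMultiplicative)
    (hGS : ∀ (W : WeierstrassCurve ℚ) [W.IsElliptic] [W.IsGloballyMinimal] (p : ℕ) [Fact p.Prime],
      greenberg_stevens (W := W) (p := p))
    (hM : mazur_not_dvd_maninConstant_of_odd)
    (hmod : hasEntireLFunction_rat) (hpar : nonempty_modularParametrizationData)
    (hGZK : rank_eq_analyticRank_of_analyticRank_le_one) (h : RowC1 W p) : BSDp W p :=
  RowC1.bsdp_of_mainConjectures_of_mazur hSU hA (greenberg_charValue_rankZero_of_Schneider1985_odd hS hMT)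
    hJs hJn hGS hM hmod hpar hGZK h

end Curve

end Summit.BirchSwinnertonDyer.Rank1Residual

end
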